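import Summits.QuantumFields.YangMills.Theses.SwapVirialDeficit
import HarnessLib

/-!
# Route `SwapVirialDeficit` (YangMills): the assembly item `Assembly` (stmt-QuantumFields-24195) holds BY NAME

`Assembly := SwapMeanActionGap → RingTraceSmooth → SwapTwistDeficit.TwistDeficitLaplaceWindow` (Assembly′ of the
P1 «RELATIVE GAP» re-glue, rev 2/3 of the route) — monotone transport of `φ(b) = log Z^S(b) − log Z(b) + (c/2)·log b`
on `[√β, β]` from the landed anchor `TT.twistTrace_le_physTrace`, giving `Z^S ≤ β^(−c/4)·Z ≤ Z/4` on the window and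
hence the twist-deficit Laplace window.  The proof is the route's own deciding theorem `SwapVirialDeficit.closes`
(planner ym-idea-4 g14, LINE g14-B, gate-written with the route file); this file closes the item by name.

HONEST FRAMING: bookkeeping; the crux `SwapMeanActionGap` (stmt-QuantumFields-24194, split into 24196/24197 + glue
24198) is OPEN, so the leaf `TwistDeficitLaplaceWindow` (stmt-QuantumFields-23776) is NOT proved here; the line is
DRAFT-by-design (closes → leaf, not `YangMills`); no summit conjunct is touched; the Yang–Mills mass gap is NOT proved.
No `sorry`, no new axiom, no new definition.
References: [cite: TomboulisYaffe1985]; [cite: tHooft1979].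
-/

set_option autoImplicit false

namespace Summit.QuantumFields.YangMills.Theorems.SwapVirialDeficit

/-- **`Assembly` holds** (item stmt-QuantumFields-24195 of route `SwapVirialDeficit`, BY NAME):
`SwapMeanActionGap → RingTraceSmooth → SwapTwistDeficit.TwistDeficitLaplaceWindow`, the route's deciding theorem
`closes`.  [cite: TomboulisYaffe1985] [cite: tHooft1979] -/
theorem assembly_proof :
    Summit.QuantumFields.YangMills.Theses.SwapVirialDeficit.Assembly :=
  fun hG hR => Summit.QuantumFields.YangMills.Theses.SwapVirialDeficit.closes hG hR

end Summit.QuantumFields.YangMills.Theorems.SwapVirialDeficit
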